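import Summits.QuantumFields.GaugeBoot.Certificates.SparseReducedWindow
import Summits.QuantumFields.GaugeBoot.Certificates.SparseAggregate
import HarnessLib

/-!
# Sparse certificate replay, part 5b: windowed residual sums and the assembled bound (window route)

HONEST FRAMING (cell `pub-gaugeboot`): certified bounds on lattice expectations at stated coupling,
gauge group, dimension and torus size; NOT a mass gap, NOT a continuum limit, NOT a string tension;
NOT Yang–Mills-summit-bearing (barriers `FixedCouplingUltralocality`, `PerturbativeInvisibility`).

Sequel of `SparseReducedWindow.lean` (raw-recursor sweep `sweepR`, semantics `getR_sweepR`, trace value `trZ`).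
Here: the integer residual numerators `N_v = (c_v · D − n_v) · P − t_v · D` (`P = 4^K`; objective coefficient
`c_v ∈ ℤ`, aggregated equality row `a_v = n_v / D`, trace value `t_v = trZ v`), the per-window contribution
`s = Σ_{v in window} g_v` (`g_0 = −N_0`, `g_v = |N_v|` for `v ≥ 1`) checked by ONE `decide` per window against an
emitted integer (`winCheck` → `WinOK`, `WinOK.append`), the aggregated row built from integer numerators (`aggRowQ`),
the final scalar check `finalCheckW`, and the assembled abstract bound `objective_bound_win`
(`JanssonChaykinKeil.lmiForm_bound` with residuals `N_v / (D · 4^K)`).  All `[folklore]`; nothing here is specific to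
lattice gauge theory.
-/

namespace Summit.QuantumFields.GaugeBoot.Certificates.Sparse

open Matrix Finset Literature.Computation.Certificates

noncomputable section

/-- `Nat.beq a b = false` from `a ≠ b`. [folklore] -/
private theorem nat_beq_false' {a b : ℕ} (h : a ≠ b) : Nat.beq a b = false := by
  cases hq : Nat.beq a b
  · rfl
  · exact absurd (Nat.eq_of_beq_eq_true hq) h

/-! ## Windowed residual sums -/

/-- Residual NUMERATOR `N_v = (c_v · D − n_v) · P − t_v · D` (`P = 4^K`; the residual is `N_v / (D · P)`). [folklore] -/
def resN (GB : List (List (List ℤ))) (EB : List (List (List (List (ℕ × ℤ))))) (nb m : ℕ) (cZ : List (ℕ × ℤ))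
    (RN : List ℤ) (P D : ℤ) (v : ℕ) : ℤ :=
  (coef cZ v * D - RN.getD v 0) * P - trZ GB EB nb m v * D

/-- Window contribution of variable `v` (specification): `−N_0` for `v = 0`, `|N_v|` otherwise. [folklore] -/
def gSpec (GB : List (List (List ℤ))) (EB : List (List (List (List (ℕ × ℤ))))) (nb m : ℕ) (cZ : List (ℕ × ℤ))
    (RN : List ℤ) (P D : ℤ) (v : ℕ) : ℤ :=
  if v = 0 then -resN GB EB nb m cZ RN P D v else |resN GB EB nb m cZ RN P D v|

/-- Kernel form of the contribution, from the integer data of one variable (explicit `Int.*` operations). [folklore] -/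
def gZ (P D : ℤ) (v : ℕ) (c n t : ℤ) : ℤ :=
  bif Nat.beq v 0 then Int.neg (Int.sub (Int.mul (Int.sub (Int.mul c D) n) P) (Int.mul t D))
  else (Int.natAbs (Int.sub (Int.mul (Int.sub (Int.mul c D) n) P) (Int.mul t D)) : ℤ)

/-- `gZ` is `gSpec` once `t` is the trace value. [folklore] -/
theorem gZ_eq (GB : List (List (List ℤ))) (EB : List (List (List (List (ℕ × ℤ))))) (nb m : ℕ)
    (cZ : List (ℕ × ℤ)) (RN : List ℤ) (P D : ℤ) (v : ℕ) :
    gZ P D v (coef cZ v) (RN.getD v 0) (trZ GB EB nb m v) = gSpec GB EB nb m cZ RN P D v := by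
  have hr : Int.sub (Int.mul (Int.sub (Int.mul (coef cZ v) D) (RN.getD v 0)) P) (Int.mul (trZ GB EB nb m v) D) =
      resN GB EB nb m cZ RN P D v := rfl
  rw [gZ, hr, gSpec]
  by_cases hv : v = 0
  · subst hv; rfl
  · rw [nat_beq_false' hv, if_neg hv, cond_false, Int.natCast_natAbs]

/-- Window walk (raw `Nat.rec`): `n` variables from `v`, numerators `ns = RN.drop v`, trie lookups at depth `d`;
the accumulator is forced after every step. [folklore] -/
def resWalkZ (d : ℕ) (tr : Trie) (cZ : List (ℕ × ℤ)) (P D : ℤ) (n : ℕ) : List ℤ → ℕ → ℤ → ℤ :=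
  @Nat.rec (fun _ => List ℤ → ℕ → ℤ → ℤ) (fun _ _ acc => acc)
    (fun _ ih ns v acc =>
      @Int.casesOn (fun _ => ℤ) (Int.add acc (gZ P D v (coef cZ v) (ns.headD 0) (Trie.getR d tr v)))
        (fun _ => ih ns.tail (v + 1) (Int.add acc (gZ P D v (coef cZ v) (ns.headD 0) (Trie.getR d tr v))))
        (fun _ => ih ns.tail (v + 1) (Int.add acc (gZ P D v (coef cZ v) (ns.headD 0) (Trie.getR d tr v))))) n

/-- Unfolding `resWalkZ` one step. [folklore] -/
theorem resWalkZ_succ (d : ℕ) (tr : Trie) (cZ : List (ℕ × ℤ)) (P D : ℤ) (n : ℕ) (ns : List ℤ) (v : ℕ)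
    (acc : ℤ) : resWalkZ d tr cZ P D (n + 1) ns v acc =
      resWalkZ d tr cZ P D n ns.tail (v + 1) (acc + gZ P D v (coef cZ v) (ns.headD 0) (Trie.getR d tr v)) := by
  have key : ∀ (A E : ℤ), @Int.casesOn (fun _ => ℤ) A (fun _ => E) (fun _ => E) = E := fun A E => by
    cases A <;> rfl
  exact key _ _

/-- `(l.drop v).headD 0 = l[v]` (default `0`). [folklore] -/
private theorem headD_drop : ∀ (l : List ℤ) (v : ℕ), (l.drop v).headD 0 = l.getD v 0
  | [], v => by simp
  | a :: l, 0 => by simp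
  | a :: l, v + 1 => by rw [List.drop_succ_cons, headD_drop l v, List.getD_cons_succ]

/-- Semantics of `resWalkZ`. [folklore] -/
theorem resWalkZ_eq (d : ℕ) (tr : Trie) (cZ : List (ℕ × ℤ)) (P D : ℤ) (RN : List ℤ) :
    ∀ (n v : ℕ) (acc : ℤ), resWalkZ d tr cZ P D n (RN.drop v) v acc =
      acc + ∑ i ∈ Finset.range n, gZ P D (v + i) (coef cZ (v + i)) (RN.getD (v + i) 0) (Trie.getR d tr (v + i))
  | 0, v, acc => by simp [resWalkZ]
  | n + 1, v, acc => by
    rw [resWalkZ_succ, List.tail_drop, headD_drop, resWalkZ_eq d tr cZ P D RN n (v + 1), Finset.sum_range_succ',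
      add_assoc, add_comm (∑ i ∈ Finset.range n, _)]
    simp only [Nat.add_zero, Nat.add_right_comm v 1, Nat.add_assoc]

/-- **Window check**: sweep the window into the trie, walk the residual numerators, compare the sum with the
emitted integer `s`. [folklore] -/
def winCheck (GB : List (List (List ℤ))) (EB : List (List (List (List (ℕ × ℤ))))) (nb m d : ℕ)
    (cZ : List (ℕ × ℤ)) (RN : List ℤ) (P D : ℤ) (lo hi : ℕ) (s : ℤ) : Bool :=
  decide (lo ≤ hi) && decide (hi ≤ 2 ^ d) &&
    decide (resWalkZ d (sweepR GB EB nb m d lo hi) cZ P D (hi - lo) (RN.drop lo) lo 0 = s)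

/-- What a window check establishes: `lo ≤ hi` and `s = Σ_{lo ≤ v < hi} gSpec v`. [folklore] -/
def WinOK (GB : List (List (List ℤ))) (EB : List (List (List (List (ℕ × ℤ))))) (nb m : ℕ)
    (cZ : List (ℕ × ℤ)) (RN : List ℤ) (P D : ℤ) (lo hi : ℕ) (s : ℤ) : Prop :=
  lo ≤ hi ∧ s = ∑ i ∈ Finset.range (hi - lo), gSpec GB EB nb m cZ RN P D (lo + i)

/-- Soundness of `winCheck` (under the family's row-length check). [folklore] -/
theorem winOK_of_check {GB : List (List (List ℤ))} {EB : List (List (List (List (ℕ × ℤ))))} {nb m d : ℕ}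
    {cZ : List (ℕ × ℤ)} {RN : List ℤ} {P D : ℤ} {lo hi : ℕ} {s : ℤ} (hrow : rowLenCheck EB m nb = true)
    (h : winCheck GB EB nb m d cZ RN P D lo hi s = true) : WinOK GB EB nb m cZ RN P D lo hi s := by
  rw [winCheck, Bool.and_eq_true, Bool.and_eq_true, decide_eq_true_eq, decide_eq_true_eq, decide_eq_true_eq] at h
  obtain ⟨⟨hlh, hd⟩, hs⟩ := h
  refine ⟨hlh, ?_⟩
  rw [← hs, resWalkZ_eq, zero_add]
  refine Finset.sum_congr rfl fun i hi' => ?_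
  rw [Finset.mem_range] at hi'
  rw [getR_sweepR hrow hd (Nat.le_add_right lo i) (by omega), gZ_eq]

/-- Concatenating windows. [folklore] -/
theorem WinOK.append {GB : List (List (List ℤ))} {EB : List (List (List (List (ℕ × ℤ))))} {nb m : ℕ}
    {cZ : List (ℕ × ℤ)} {RN : List ℤ} {P D : ℤ} {lo mid hi : ℕ} {s₁ s₂ : ℤ}
    (h1 : WinOK GB EB nb m cZ RN P D lo mid s₁) (h2 : WinOK GB EB nb m cZ RN P D mid hi s₂) :
    WinOK GB EB nb m cZ RN P D lo hi (s₁ + s₂) := by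
  obtain ⟨hlm, hs1⟩ := h1
  obtain ⟨hmh, hs2⟩ := h2
  refine ⟨le_trans hlm hmh, ?_⟩
  rw [hs1, hs2, show hi - lo = (mid - lo) + (hi - mid) by omega, Finset.sum_range_add]
  congr 1
  refine Finset.sum_congr rfl fun i _ => ?_
  rw [show lo + (mid - lo + i) = mid + i by omega]

/-! ## The aggregated row from integer numerators -/

/-- The aggregated equality row `[(0, n_0 / D), (1, n_1 / D), …]` from integer numerators. [folklore] -/
def aggRowQ (RN : List ℤ) (D : ℕ) : List (ℕ × ℚ) := zipIdx 0 (RN.map fun n : ℤ => (n : ℚ) / D)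

/-- Lookup in `aggRowQ`. [folklore] -/
theorem sget_aggRowQ (RN : List ℤ) (D : ℕ) (v : ℕ) : sget (aggRowQ RN D) v = ((RN.getD v 0 : ℤ) : ℚ) / D := by
  rw [aggRowQ, sget_zipIdx_zero, show (0 : ℚ) = (fun n : ℤ => (n : ℚ) / D) 0 by simp, List.getD_map]

/-- Lookup in `aggRowQ`, cast to `ℝ`. [folklore] -/
theorem cast_sget_aggRowQ (RN : List ℤ) (D : ℕ) (v : ℕ) :
    ((sget (aggRowQ RN D) v : ℚ) : ℝ) = ((RN.getD v 0 : ℤ) : ℝ) / (D : ℝ) := by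
  rw [sget_aggRowQ]; push_cast; rfl

/-! ## The assembled bound (aggregated-equality form, windowed residuals) -/

/-- **Summed trace identity without a table**: `Σ_k tr (Z_k/4^K · F⁽ᵏ⁾_v) = trZ v / 4^K` with the Gram duals
`Z_k = G_k G_kᵀ` read from the factor rows and all blocks padded to `m × m`. [folklore] -/
theorem sum_trace_zr_mul_fzE_eq_trZ (GB : List (List (List ℤ))) (EB : List (List (List (List (ℕ × ℤ)))))
    (nb m K : ℕ) {nv : ℕ} (v : Fin nv) :
    ∑ k : Fin nb, trace (zr (GB.getD k.val []) m K * (fzE EB k.val m v.val).map (Int.cast : ℤ → ℝ)) =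
      ((trZ GB EB nb m v.val : ℤ) : ℝ) / 4 ^ K := by
  have hterm : ∀ (k : Fin nb) (i j : Fin m),
      zr (GB.getD k.val []) m K i j * ((fzE EB k.val m v.val).map (Int.cast : ℤ → ℝ)) j i =
        ((posTerm GB EB v.val (k.val, i.val, j.val) : ℤ) : ℝ) / 4 ^ K := by
    intro k i j
    simp only [zr, zmat, fzE, posTerm, Matrix.smul_apply, Matrix.map_apply, Matrix.of_apply,
      smul_eq_mul]
    push_cast
    ring
  simp only [Matrix.trace, Matrix.diag_apply, Matrix.mul_apply, hterm]
  rw [trZ]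
  push_cast
  simp only [Finset.sum_div]
  rw [← Fin.sum_univ_eq_sum_range]
  refine Finset.sum_congr rfl fun k _ => ?_
  rw [← Fin.sum_univ_eq_sum_range]
  refine Finset.sum_congr rfl fun i _ => ?_
  rw [← Fin.sum_univ_eq_sum_range]

/-- Final scalar check: `lower ≤ (rhs_N · 4^K − S) / (D · 4^K)`. [folklore] -/
def finalCheckW (rhsN S : ℤ) (D K : ℕ) (lower : ℚ) : Bool :=
  decide (lower ≤ ((rhsN * 4 ^ K - S : ℤ) : ℚ) / ((D : ℚ) * 4 ^ K))

/-- **Certified lower bound on the objective — reduced blocks, windowed residuals, aggregated equality.**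
For integer objective coefficients `c_v = coef cZ v`, ONE aggregated equality row `Σ_v (n_v / D) y_v = rhs_N / D`
(`n_v = RN[v]`), Gram duals from the factor rows `GB` (`lenCheckAll`), reduced entry tables `EB` (`dimCheck`),
the window statement `WinOK … 0 (nv+1) S` and the scalar check `finalCheckW rhsN S D K lower`: every real `y`
with `y_0 = 1`, `|y_v| ≤ 1`, the aggregated equality and all reduced blocks PSD satisfies `lower ≤ c · y`.
(Proof: `JanssonChaykinKeil.lmiForm_bound` with residuals `r_v = N_v / (D · 4^K)`.) [folklore] -/
theorem objective_bound_win {nv nb m K D : ℕ} (cZ : List (ℕ × ℤ)) (RN : List ℤ) (rhsN : ℤ)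
    (GB : List (List (List ℤ))) (EB : List (List (List (List (ℕ × ℤ))))) (dimL : List ℕ) (lower : ℚ) (S : ℤ)
    (hD : 0 < D)
    (hwin : WinOK GB EB nb m cZ RN ((4 : ℤ) ^ K) (D : ℤ) 0 (nv + 1) S)
    (hfin : finalCheckW rhsN S D K lower = true)
    (hlen : lenCheckAll GB m nb = true) (hdim : dimCheck EB dimL m nb = true)
    {y : Fin (nv + 1) → ℝ} (hy0 : y 0 = 1) (hρ : ∀ v : Fin (nv + 1), v ≠ 0 → |y v| ≤ 1)
    (hagg : ∑ v : Fin (nv + 1), ((RN.getD v.val 0 : ℤ) : ℝ) / (D : ℝ) * y v = (rhsN : ℝ) / (D : ℝ))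
    (hpsd : ∀ k : Fin nb, (redE EB k.val (dimL.getD k.val 0) (nv + 1) y).PosSemidef) :
    ((lower : ℚ) : ℝ) ≤ ∑ v : Fin (nv + 1), ((coef cZ v.val : ℤ) : ℝ) * y v := by
  have hD' : (0 : ℝ) < D := by exact_mod_cast hD
  have hDne : (D : ℝ) ≠ 0 := ne_of_gt hD'
  have hP : (0 : ℝ) < 4 ^ K := by positivity
  have hDP : (0 : ℝ) < (D : ℝ) * 4 ^ K := mul_pos hD' hP
  -- residuals `r_v = N_v / (D · 4^K)` as a function on ℕ
  have h := JanssonChaykinKeil.lmiForm_bound (V := Fin (nv + 1)) (E := Fin 1) (I := Fin 0)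
    (K := Fin nb) (σ := fun _ => Fin m)
    (fun v => ((coef cZ v.val : ℤ) : ℝ)) 0 0
    (fun _ v => ((RN.getD v.val 0 : ℤ) : ℝ) / (D : ℝ)) (fun _ => (rhsN : ℝ) / (D : ℝ))
    (fun i => Fin.elim0 i) (fun i => Fin.elim0 i)
    (fun _ => 0) (fun k v => (fzE EB k.val m v.val).map (Int.cast : ℤ → ℝ)) (fun _ => 1)
    (fun k => trace (∑ v, y v • (fzE EB k.val m v.val).map (Int.cast : ℤ → ℝ)))
    (y := y) hy0 hρ (fun _ => hagg) (fun i => Fin.elim0 i)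
    (fun k => by rw [zero_add]; exact posSemidef_gramE_of_redE hdim k.isLt (hpsd k)) (fun k => by simp)
    (fun _ => 1) (fun i => Fin.elim0 i) (fun i => Fin.elim0 i)
    (fun k => zr (GB.getD k.val []) m K) (fun _ => 0)
    (fun k => by simpa using zr_posSemidef K (lenCheck_of_all hlen k))
    (fun v => ((resN GB EB nb m cZ RN ((4 : ℤ) ^ K) (D : ℤ) v.val : ℤ) : ℝ) / ((D : ℝ) * 4 ^ K))
    (fun v => by
      simp only [Finset.univ_unique, Fin.default_eq_zero, Finset.sum_singleton, one_mul,
        Finset.univ_eq_empty, Finset.sum_empty, add_zero]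
      rw [sum_trace_zr_mul_fzE_eq_trZ GB EB nb m K v, resN]
      push_cast
      field_simp)
    (((resN GB EB nb m cZ RN ((4 : ℤ) ^ K) (D : ℤ) 0 : ℤ) : ℝ) / ((D : ℝ) * 4 ^ K) + (rhsN : ℝ) / (D : ℝ))
    (by simp)
  -- simplify the JCK conclusion
  simp only [min_self, abs_zero, zero_mul, Finset.sum_const_zero, sub_zero, add_zero, mul_one] at h
  -- the window statement
  obtain ⟨_, hS⟩ := hwin
  rw [Nat.sub_zero, Finset.sum_range_succ'] at hS
  simp only [zero_add, gSpec, Nat.add_one_ne_zero, if_false, if_true] at hS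
  -- the final check, cast to ℝ
  have hfin' : ((lower : ℚ) : ℝ) ≤ (((rhsN * 4 ^ K - S : ℤ) : ℚ) : ℝ) / ((D : ℝ) * 4 ^ K) := by
    rw [finalCheckW, decide_eq_true_eq] at hfin
    have := (Rat.cast_le (K := ℝ)).mpr hfin
    push_cast at this ⊢
    exact this
  -- Σ_{v ≠ 0} |r v| as a range sum over ℕ
  have herase : ∑ v ∈ Finset.univ.erase (0 : Fin (nv + 1)),
      |((resN GB EB nb m cZ RN ((4 : ℤ) ^ K) (D : ℤ) v.val : ℤ) : ℝ) / ((D : ℝ) * 4 ^ K)| =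
      ∑ i ∈ Finset.range nv, |((resN GB EB nb m cZ RN ((4 : ℤ) ^ K) (D : ℤ) (i + 1) : ℤ) : ℝ) / ((D : ℝ) * 4 ^ K)| := by
    have h1 := Finset.add_sum_erase (Finset.univ : Finset (Fin (nv + 1)))
      (fun v => |((resN GB EB nb m cZ RN ((4 : ℤ) ^ K) (D : ℤ) v.val : ℤ) : ℝ) / ((D : ℝ) * 4 ^ K)|)
      (Finset.mem_univ 0)
    rw [Fin.sum_univ_succ] at h1
    have h2 := add_left_cancel h1
    rw [h2, ← Fin.sum_univ_eq_sum_range]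
    rfl
  rw [herase] at h
  refine le_trans hfin' (le_trans (le_of_eq ?_) h)
  -- the identity (rhsN·4^K − S)/(D·4^K) = r 0 + rhsN/D − Σ |r (i+1)|
  have habs : ∀ i ∈ Finset.range nv,
      |((resN GB EB nb m cZ RN ((4 : ℤ) ^ K) (D : ℤ) (i + 1) : ℤ) : ℝ) / ((D : ℝ) * 4 ^ K)| =
      |((resN GB EB nb m cZ RN ((4 : ℤ) ^ K) (D : ℤ) (i + 1) : ℤ) : ℝ)| / ((D : ℝ) * 4 ^ K) := by
    intro i _
    rw [abs_div, abs_of_pos hDP]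
  rw [Finset.sum_congr rfl habs, ← Finset.sum_div, hS]
  push_cast
  field_simp
  ring

end

end Summit.QuantumFields.GaugeBoot.Certificates.Sparse
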